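import Summits.Ventures.WeilGRH.ZetaWindowPhaseBlind
import HarnessLib

/-!
# rh-explicit (venture WeilGRH): THE PHASE-FREE HORIZON (I) — the prime sum of the window `a = 3/2`, read
  phase-locked: `−2Σ_{n≤20} Λ(n)n^{-1/2}(1 − log n/3)cos(τ log n) ≤ 2.8959` for every height `τ`

Cell `rh-explicit`, WEIL TRACK (structure seat weil-3, gen12).  `ZetaLowZerosSimple` (gen11) read the PROVED frontier
window `a₀ = 4023/5000` (prime powers `2, 3, 4`) phase-locked and certified simplicity on `3 ≤ |γ| ≤ 62.5` (14 zeros),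
optimally for that window (`PhaseLockedSupremum`).  The structure seat's scan (WEIL3-STRUCTURE §19.7) located the best
window over ALL half-lengths at `a ≈ 3/2` (prime powers `n ≤ 20`): the phase-LOCKED worst case of the prime sum is
`2.8958`, the slack `4a − 2.8958 = 3.104` the largest, and the phase-free horizon `≈ 136–138` — the ABSOLUTE horizon
of phase-free certification.  This file types it (the rung `a = 3/2` is NOT proved; under RH it holds):

* `sum_weilPrimeIndex_three_halves`: on the window `a = 3/2` the prime sum runs over
  `n ∈ {2,3,4,5,7,8,9,11,13,16,17,19}` (`e³ ∈ (20, 21)`);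
* `neg_two_mul_cos_flatSum_three_halves_le`: **`−2Σ_n c_n cos(τ log n) ≤ 2.8959` for every `τ`**
  (`c_n = Λ(n)n^{-1/2}(1 − log n/3)`; the powers of `2` are LOCKED: `−2Σ_{k≤4} c_{2^k}cos(kθ) ≤ 2(c₂ − c₄ + c₈ − c₁₆)`
  since the quartic factors as `(1 + cos θ)·q(cos θ)` with `q ≥ 0` on `[−1,1]`; the powers of `3`: `c₃ ≥ 4c₉`;
  `5, 7, 11, 13, 17, 19` free);
* (the budget pieces, the atom bound and the RH corollary — the 45 lowest zeros are simple — are `ZetaHorizonWindow`).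

No definitions, no named facts; RH-free; standard axioms.
-/

set_option autoImplicit false

noncomputable section

open Complex Filter Set MeasureTheory
open scoped Real Topology ArithmeticFunction.vonMangoldt

namespace Summit.Ventures.WeilGRH

open Literature.NumberTheory.LFunctions
open Literature.NumberTheory.LFunctions.Yoshida1992 (chi)

/-! ## The window `a = 3/2`: prime powers `n ≤ 20` -/

/-- `20 < e³ < 21`. -/
theorem exp_three_bounds : (20 : ℝ) < Real.exp 3 ∧ Real.exp 3 < 21 := by
  have h1 := Real.exp_one_gt_d9
  have h2 := Real.exp_one_lt_d9
  have he : Real.exp 3 = Real.exp 1 ^ 3 := by rw [← Real.exp_nat_mul]; norm_num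
  rw [he]
  have hlo : (2.718 : ℝ) ^ 3 < Real.exp 1 ^ 3 := pow_lt_pow_left₀ (by linarith) (by norm_num) (by norm_num)
  have hhi : Real.exp 1 ^ 3 < (2.7183 : ℝ) ^ 3 :=
    pow_lt_pow_left₀ (by linarith) (Real.exp_pos 1).le (by norm_num)
  constructor <;> nlinarith

/-- Membership in the window `a = 3/2`: `n ∈ weilPrimeIndex (3/2) ↔ n ≤ 20`. -/
theorem mem_weilPrimeIndex_three_halves {n : ℕ} : n ∈ weilPrimeIndex (3 / 2 : ℝ) ↔ n ≤ 20 := by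
  rw [mem_weilPrimeIndex, show (2 : ℝ) * (3 / 2) = 3 by norm_num]
  obtain ⟨h20, h21⟩ := exp_three_bounds
  constructor
  · intro h
    by_contra hn
    have hn21 : (21 : ℝ) ≤ n := by exact_mod_cast (by omega : 21 ≤ n)
    have hpos : (0 : ℝ) < n := by linarith
    have := (Real.log_lt_iff_lt_exp hpos).1 h
    linarith
  · intro h
    rcases Nat.eq_zero_or_pos n with rfl | hn
    · simp
    · have hpos : (0 : ℝ) < n := by exact_mod_cast hn
      rw [Real.log_lt_iff_lt_exp hpos]
      have : (n : ℝ) ≤ 20 := by exact_mod_cast h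
      linarith

/-- A natural number divisible by two distinct primes is not a prime power. -/
theorem not_isPrimePow_of_two_primes {n p q : ℕ} (hp : p.Prime) (hq : q.Prime) (hpq : p ≠ q) (hpn : p ∣ n)
    (hqn : q ∣ n) : ¬IsPrimePow n := by
  intro h
  obtain ⟨r, -, huniq⟩ := (isPrimePow_iff_unique_prime_dvd.1 h)
  exact hpq ((huniq p ⟨hp, hpn⟩).trans (huniq q ⟨hq, hqn⟩).symm)

/-- **The prime sum of the window `a = 3/2`** runs over `n ∈ {2,3,4,5,7,8,9,11,13,16,17,19}`:
`Σ_{n ∈ weilPrimeIndex 3/2} Λ(n)n^{-1/2}F(n) = Σ` of the twelve terms with `Λ(p^k) = log p`. -/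
theorem sum_weilPrimeIndex_three_halves (F : ℕ → ℝ) :
    ∑ n ∈ weilPrimeIndex (3 / 2 : ℝ), (Λ n : ℝ) / Real.sqrt n * F n =
      Real.log 2 / Real.sqrt 2 * F 2 + Real.log 3 / Real.sqrt 3 * F 3 + Real.log 2 / 2 * F 4 +
        Real.log 5 / Real.sqrt 5 * F 5 + Real.log 7 / Real.sqrt 7 * F 7 + Real.log 2 / Real.sqrt 8 * F 8 +
        Real.log 3 / 3 * F 9 + Real.log 11 / Real.sqrt 11 * F 11 + Real.log 13 / Real.sqrt 13 * F 13 +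
        Real.log 2 / 4 * F 16 + Real.log 17 / Real.sqrt 17 * F 17 + Real.log 19 / Real.sqrt 19 * F 19 := by
  classical
  set T : Finset ℕ := {2, 3, 4, 5, 7, 8, 9, 11, 13, 16, 17, 19} with hT
  have hsub : T ⊆ weilPrimeIndex (3 / 2 : ℝ) := by
    intro n hn
    rw [mem_weilPrimeIndex_three_halves]
    simp only [hT, Finset.mem_insert, Finset.mem_singleton] at hn
    omega
  have hzero : ∀ n ∈ weilPrimeIndex (3 / 2 : ℝ), n ∉ T → (Λ n : ℝ) / Real.sqrt n * F n = 0 := by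
    intro n hn hnT
    rw [mem_weilPrimeIndex_three_halves] at hn
    have hΛ : (Λ n : ℝ) = 0 := by
      rw [ArithmeticFunction.vonMangoldt_eq_zero_iff]
      simp only [hT, Finset.mem_insert, Finset.mem_singleton] at hnT
      have h23 : ∀ m : ℕ, 2 ∣ m → 3 ∣ m → ¬IsPrimePow m := fun m h2 h3 ↦
        not_isPrimePow_of_two_primes Nat.prime_two Nat.prime_three (by norm_num) h2 h3
      have h25 : ∀ m : ℕ, 2 ∣ m → 5 ∣ m → ¬IsPrimePow m := fun m h2 h5 ↦
        not_isPrimePow_of_two_primes Nat.prime_two Nat.prime_five (by norm_num) h2 h5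
      have h27 : ∀ m : ℕ, 2 ∣ m → 7 ∣ m → ¬IsPrimePow m := fun m h2 h7 ↦
        not_isPrimePow_of_two_primes Nat.prime_two (by norm_num) (by norm_num) h2 h7
      have h35 : ∀ m : ℕ, 3 ∣ m → 5 ∣ m → ¬IsPrimePow m := fun m h3 h5 ↦
        not_isPrimePow_of_two_primes Nat.prime_three Nat.prime_five (by norm_num) h3 h5
      interval_cases n
      · exact not_isPrimePow_zero
      · exact not_isPrimePow_one
      · omega
      · omega
      · omega
      · omega
      · exact h23 6 (by norm_num) (by norm_num)
      · omega
      · omega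
      · omega
      · exact h25 10 (by norm_num) (by norm_num)
      · omega
      · exact h23 12 (by norm_num) (by norm_num)
      · omega
      · exact h27 14 (by norm_num) (by norm_num)
      · exact h35 15 (by norm_num) (by norm_num)
      · omega
      · omega
      · exact h23 18 (by norm_num) (by norm_num)
      · omega
      · exact h25 20 (by norm_num) (by norm_num)
    rw [hΛ, zero_div, zero_mul]
  rw [← Finset.sum_subset hsub hzero]
  have hΛ4 : (Λ 4 : ℝ) = Real.log 2 := by
    rw [show (4 : ℕ) = 2 ^ 2 by norm_num, ArithmeticFunction.vonMangoldt_apply_pow (by norm_num),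
      ArithmeticFunction.vonMangoldt_apply_prime Nat.prime_two]; norm_cast
  have hΛ8 : (Λ 8 : ℝ) = Real.log 2 := by
    rw [show (8 : ℕ) = 2 ^ 3 by norm_num, ArithmeticFunction.vonMangoldt_apply_pow (by norm_num),
      ArithmeticFunction.vonMangoldt_apply_prime Nat.prime_two]; norm_cast
  have hΛ16 : (Λ 16 : ℝ) = Real.log 2 := by
    rw [show (16 : ℕ) = 2 ^ 4 by norm_num, ArithmeticFunction.vonMangoldt_apply_pow (by norm_num),
      ArithmeticFunction.vonMangoldt_apply_prime Nat.prime_two]; norm_cast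
  have hΛ9 : (Λ 9 : ℝ) = Real.log 3 := by
    rw [show (9 : ℕ) = 3 ^ 2 by norm_num, ArithmeticFunction.vonMangoldt_apply_pow (by norm_num),
      ArithmeticFunction.vonMangoldt_apply_prime Nat.prime_three]; norm_cast
  have hp : ∀ p : ℕ, p.Prime → (Λ p : ℝ) = Real.log p := fun p hp ↦
    ArithmeticFunction.vonMangoldt_apply_prime hp
  have hsqrt4 : Real.sqrt ((4 : ℕ) : ℝ) = 2 := by
    rw [show ((4 : ℕ) : ℝ) = 2 ^ 2 by norm_num, Real.sqrt_sq (by norm_num)]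
  have hsqrt9 : Real.sqrt ((9 : ℕ) : ℝ) = 3 := by
    rw [show ((9 : ℕ) : ℝ) = 3 ^ 2 by norm_num, Real.sqrt_sq (by norm_num)]
  have hsqrt16 : Real.sqrt ((16 : ℕ) : ℝ) = 4 := by
    rw [show ((16 : ℕ) : ℝ) = 4 ^ 2 by norm_num, Real.sqrt_sq (by norm_num)]
  rw [hT]
  repeat rw [Finset.sum_insert (by decide)]
  rw [Finset.sum_singleton, hp 2 Nat.prime_two, hp 3 Nat.prime_three, hΛ4, hp 5 Nat.prime_five,
    hp 7 (by norm_num), hΛ8, hΛ9, hp 11 (by norm_num), hp 13 (by norm_num), hΛ16, hp 17 (by norm_num),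
    hp 19 (by norm_num), hsqrt4, hsqrt9, hsqrt16]
  push_cast
  ring

/-! ## The coefficients `c_n = Λ(n) n^{-1/2}(1 − log n/3)` and the phase-locked prime sum -/

/-- Interval product: `xl ≤ x ≤ xh`, `yl ≤ y ≤ yh`, `0 ≤ xl`, `0 ≤ yl` ⟹ `xl·yl ≤ x·y ≤ xh·yh`. -/
private theorem mul_mem_bounds {x y xl xh yl yh : ℝ} (hx : xl ≤ x) (hx' : x ≤ xh) (hy : yl ≤ y) (hy' : y ≤ yh)
    (hxl : 0 ≤ xl) (hyl : 0 ≤ yl) : xl * yl ≤ x * y ∧ x * y ≤ xh * yh :=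
  ⟨mul_le_mul hx hy hyl (hxl.trans hx), mul_le_mul hx' hy' (hyl.trans hy) (hxl.trans (hx.trans hx'))⟩

/-- `2.94305 ≤ log 19 ≤ 2.94721` (`2³·3²·5 = 360 < 19² < 363 = 3·11²`). -/
theorem log_nineteen_bounds : (2.94305 : ℝ) ≤ Real.log 19 ∧ Real.log 19 ≤ 2.94721 := by
  have hl2 := Real.log_two_gt_d9
  have hl2' := Real.log_two_lt_d9
  obtain ⟨hl3, hl3'⟩ := KadiriNumerics.log_3_bounds
  obtain ⟨hl5, -⟩ := KadiriNumerics.log_5_bounds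
  obtain ⟨-, hl11⟩ := KadiriNumerics.log_11_bounds
  have h19 : Real.log ((19 : ℝ) ^ 2) = 2 * Real.log 19 := by rw [Real.log_pow]; norm_num
  have hlo : Real.log 360 ≤ Real.log ((19 : ℝ) ^ 2) := Real.log_le_log (by norm_num) (by norm_num)
  have hhi : Real.log ((19 : ℝ) ^ 2) ≤ Real.log 363 := Real.log_le_log (by norm_num) (by norm_num)
  have h360 : Real.log 360 = 3 * Real.log 2 + 2 * Real.log 3 + Real.log 5 := by
    rw [show (360 : ℝ) = 2 ^ 3 * 3 ^ 2 * 5 by norm_num, Real.log_mul (by norm_num) (by norm_num),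
      Real.log_mul (by norm_num) (by norm_num), Real.log_pow, Real.log_pow]; push_cast; ring
  have h363 : Real.log 363 = Real.log 3 + 2 * Real.log 11 := by
    rw [show (363 : ℝ) = 3 * 11 ^ 2 by norm_num, Real.log_mul (by norm_num) (by norm_num), Real.log_pow]
    push_cast; ring
  rw [h19] at hlo hhi; rw [h360] at hlo; rw [h363] at hhi
  constructor <;> linarith

set_option maxHeartbeats 400000 in
/-- **THE PHASE-LOCKED PRIME SUM OF THE WINDOW `a = 3/2`**: for every real `τ`,

  `−2 Σ_{n ≤ 20} Λ(n) n^{-1/2}(1 − log n/3) cos(τ log n) ≤ 2.8959`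

(powers of `2` locked through `cos(kτ log 2)`: the quartic `h(x) − h(−1) = (1+x)·[A + Bx + x²(C + Dx)]` with
`A = c₂ − 2c₄ + c₈ ≥ B = 2c₄ − 4c₈ ≥ 0`, `C = 4c₈ − 8c₁₆ ≥ D = 8c₁₆ ≥ 0`; powers of `3` locked: `c₃ ≥ 4c₉`;
`5, 7, 11, 13, 17, 19` at their free worst case).  The fully phase-blind value is `4.0853`. -/
theorem neg_two_mul_cos_flatSum_three_halves_le (τ : ℝ) :
    -(2 * (∑ n ∈ weilPrimeIndex (3 / 2 : ℝ), (Λ n : ℝ) / Real.sqrt n *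
        ((1 - Real.log n / (2 * (3 / 2 : ℝ))) * Real.cos (τ * Real.log n)))) ≤ 2.8959 := by
  rw [sum_weilPrimeIndex_three_halves]
  push_cast
  -- logarithms of prime powers
  have hlog4 : Real.log 4 = 2 * Real.log 2 := by
    rw [show (4 : ℝ) = 2 ^ 2 by norm_num, Real.log_pow]; norm_num
  have hlog8 : Real.log 8 = 3 * Real.log 2 := by
    rw [show (8 : ℝ) = 2 ^ 3 by norm_num, Real.log_pow]; norm_num
  have hlog16 : Real.log 16 = 4 * Real.log 2 := by
    rw [show (16 : ℝ) = 2 ^ 4 by norm_num, Real.log_pow]; norm_num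
  have hlog9 : Real.log 9 = 2 * Real.log 3 := by
    rw [show (9 : ℝ) = 3 ^ 2 by norm_num, Real.log_pow]; norm_num
  -- multiple angles for the powers of `2` and `3`
  set x := Real.cos (τ * Real.log 2) with hx
  set y := Real.cos (τ * Real.log 3) with hy
  have hcos4 : Real.cos (τ * Real.log 4) = 2 * x ^ 2 - 1 := by
    rw [hlog4, show τ * (2 * Real.log 2) = 2 * (τ * Real.log 2) by ring, Real.cos_two_mul]
  have hcos8 : Real.cos (τ * Real.log 8) = 4 * x ^ 3 - 3 * x := by
    rw [hlog8, show τ * (3 * Real.log 2) = 3 * (τ * Real.log 2) by ring, Real.cos_three_mul]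
  have hcos16 : Real.cos (τ * Real.log 16) = 8 * x ^ 4 - 8 * x ^ 2 + 1 := by
    rw [hlog16, show τ * (4 * Real.log 2) = 2 * (2 * (τ * Real.log 2)) by ring, Real.cos_two_mul,
      Real.cos_two_mul]; ring
  have hcos9 : Real.cos (τ * Real.log 9) = 2 * y ^ 2 - 1 := by
    rw [hlog9, show τ * (2 * Real.log 3) = 2 * (τ * Real.log 3) by ring, Real.cos_two_mul]
  rw [hcos4, hcos8, hcos16, hcos9, hlog4, hlog8, hlog16, hlog9]
  have hx1 : -1 ≤ x := Real.neg_one_le_cos _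
  have hx2 : x ≤ 1 := Real.cos_le_one _
  have hy1 : -1 ≤ y := Real.neg_one_le_cos _
  have hy2 : y ≤ 1 := Real.cos_le_one _
  have hc5 := Real.neg_one_le_cos (τ * Real.log 5)
  have hc7 := Real.neg_one_le_cos (τ * Real.log 7)
  have hc11 := Real.neg_one_le_cos (τ * Real.log 11)
  have hc13 := Real.neg_one_le_cos (τ * Real.log 13)
  have hc17 := Real.neg_one_le_cos (τ * Real.log 17)
  have hc19 := Real.neg_one_le_cos (τ * Real.log 19)
  -- enclosures
  have hl2 := Real.log_two_gt_d9
  have hl2' := Real.log_two_lt_d9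
  obtain ⟨hl3, hl3'⟩ := KadiriNumerics.log_3_bounds
  obtain ⟨hl5, hl5'⟩ := KadiriNumerics.log_5_bounds
  obtain ⟨hl7, hl7'⟩ := KadiriNumerics.log_7_bounds
  obtain ⟨hl11, hl11'⟩ := KadiriNumerics.log_11_bounds
  obtain ⟨hl13, hl13'⟩ := KadiriNumerics.log_13_bounds
  obtain ⟨hl17, hl17'⟩ := KadiriNumerics.log_17_bounds
  obtain ⟨hl19, hl19'⟩ := log_nineteen_bounds
  have hs2 : (1.41421356 : ℝ) ≤ Real.sqrt 2 := Real.le_sqrt_of_sq_le (by norm_num)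
  have hs2' : Real.sqrt 2 ≤ 1.41421357 := by
    rw [show (1.41421357 : ℝ) = Real.sqrt (1.41421357 ^ 2) by rw [Real.sqrt_sq (by norm_num)]]
    exact Real.sqrt_le_sqrt (by norm_num)
  have hs3 : (1.7320508 : ℝ) ≤ Real.sqrt 3 := Real.le_sqrt_of_sq_le (by norm_num)
  have hs3' : Real.sqrt 3 ≤ 1.7320509 := by
    rw [show (1.7320509 : ℝ) = Real.sqrt (1.7320509 ^ 2) by rw [Real.sqrt_sq (by norm_num)]]
    exact Real.sqrt_le_sqrt (by norm_num)
  have hs5 : (2.2360679 : ℝ) ≤ Real.sqrt 5 := Real.le_sqrt_of_sq_le (by norm_num)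
  have hs7 : (2.6457513 : ℝ) ≤ Real.sqrt 7 := Real.le_sqrt_of_sq_le (by norm_num)
  have hs8 : Real.sqrt 8 = 2 * Real.sqrt 2 := by
    rw [show (8 : ℝ) = 2 ^ 2 * 2 by norm_num, Real.sqrt_mul (by norm_num), Real.sqrt_sq (by norm_num)]
  have hs11 : (3.3166247 : ℝ) ≤ Real.sqrt 11 := Real.le_sqrt_of_sq_le (by norm_num)
  have hs13 : (3.6055512 : ℝ) ≤ Real.sqrt 13 := Real.le_sqrt_of_sq_le (by norm_num)
  have hs17 : (4.1231056 : ℝ) ≤ Real.sqrt 17 := Real.le_sqrt_of_sq_le (by norm_num)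
  have hs19 : (4.3588989 : ℝ) ≤ Real.sqrt 19 := Real.le_sqrt_of_sq_le (by norm_num)
  rw [hs8]
  have hs2pos : (0 : ℝ) < Real.sqrt 2 := by linarith only [hs2]
  have hs3pos : (0 : ℝ) < Real.sqrt 3 := by linarith only [hs3]
  -- the `X = log p/√n` factors
  have hX2 : 0.490129 ≤ Real.log 2 / Real.sqrt 2 ∧ Real.log 2 / Real.sqrt 2 ≤ 0.4901292 := by
    constructor
    · rw [le_div_iff₀ hs2pos]; linarith only [hs2', hl2]
    · rw [div_le_iff₀ hs2pos]; linarith only [hs2, hl2']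
  have hX8 : 0.2450645 ≤ Real.log 2 / (2 * Real.sqrt 2) ∧ Real.log 2 / (2 * Real.sqrt 2) ≤ 0.2450646 := by
    constructor
    · rw [le_div_iff₀ (by positivity)]; linarith only [hs2', hl2]
    · rw [div_le_iff₀ (by positivity)]; linarith only [hs2, hl2']
  have hX3 : 0.634284 ≤ Real.log 3 / Real.sqrt 3 ∧ Real.log 3 / Real.sqrt 3 ≤ 0.6342842 := by
    constructor
    · rw [le_div_iff₀ hs3pos]; linarith only [hs3', hl3]
    · rw [div_le_iff₀ hs3pos]; linarith only [hs3, hl3']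
  have hX5 : Real.log 5 / Real.sqrt 5 ≤ 0.7197626 := by
    rw [div_le_iff₀ (by linarith only [hs5])]; linarith only [hs5, hl5']
  have hX7 : Real.log 7 / Real.sqrt 7 ≤ 0.735485 := by
    rw [div_le_iff₀ (by linarith only [hs7])]; linarith only [hs7, hl7']
  have hX11 : Real.log 11 / Real.sqrt 11 ≤ 0.7229927 := by
    rw [div_le_iff₀ (by linarith only [hs11])]; linarith only [hs11, hl11']
  have hX13 : Real.log 13 / Real.sqrt 13 ≤ 0.711389 := by
    rw [div_le_iff₀ (by linarith only [hs13])]; linarith only [hs13, hl13']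
  have hX17 : Real.log 17 / Real.sqrt 17 ≤ 0.6871552 := by
    rw [div_le_iff₀ (by linarith only [hs17])]; linarith only [hs17, hl17']
  have hX19 : Real.log 19 / Real.sqrt 19 ≤ 0.67614 := by
    rw [div_le_iff₀ (by linarith only [hs19])]; linarith only [hs19, hl19']
  have hX5' : 0 ≤ Real.log 5 / Real.sqrt 5 := div_nonneg (by linarith only [hl5]) (by linarith only [hs5])
  have hX7' : 0 ≤ Real.log 7 / Real.sqrt 7 := div_nonneg (by linarith only [hl7]) (by linarith only [hs7])
  have hX11' : 0 ≤ Real.log 11 / Real.sqrt 11 := div_nonneg (by linarith only [hl11]) (by linarith only [hs11])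
  have hX13' : 0 ≤ Real.log 13 / Real.sqrt 13 := div_nonneg (by linarith only [hl13]) (by linarith only [hs13])
  have hX17' : 0 ≤ Real.log 17 / Real.sqrt 17 := div_nonneg (by linarith only [hl17]) (by linarith only [hs17])
  have hX19' : 0 ≤ Real.log 19 / Real.sqrt 19 := div_nonneg (by linarith only [hl19]) (by linarith only [hs19])
  -- the coefficients of the powers of 2 and 3 (two-sided)
  obtain ⟨hc2l, hc2h⟩ := mul_mem_bounds hX2.1 hX2.2 (show (0.76895093 : ℝ) ≤ 1 - Real.log 2 / (2 * (3 / 2)) by linarith only [hl2, hl2'])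
    (show 1 - Real.log 2 / (2 * (3 / 2)) ≤ 0.76895095 by linarith only [hl2, hl2']) (by norm_num) (by norm_num)
  obtain ⟨hc4l, hc4h⟩ := mul_mem_bounds (show (0.34657359 : ℝ) ≤ Real.log 2 / 2 by linarith only [hl2, hl2'])
    (show Real.log 2 / 2 ≤ 0.3465736 by linarith only [hl2, hl2']) (show (0.53790187 : ℝ) ≤ 1 - 2 * Real.log 2 / (2 * (3 / 2)) by linarith only [hl2, hl2'])
    (show 1 - 2 * Real.log 2 / (2 * (3 / 2)) ≤ 0.53790189 by linarith only [hl2, hl2']) (by norm_num) (by norm_num)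
  obtain ⟨hc8l, hc8h⟩ := mul_mem_bounds hX8.1 hX8.2 (show (0.30685281 : ℝ) ≤ 1 - 3 * Real.log 2 / (2 * (3 / 2)) by linarith only [hl2, hl2'])
    (show 1 - 3 * Real.log 2 / (2 * (3 / 2)) ≤ 0.30685283 by linarith only [hl2, hl2']) (by norm_num) (by norm_num)
  obtain ⟨hc16l, hc16h⟩ := mul_mem_bounds (show (0.173286795 : ℝ) ≤ Real.log 2 / 4 by linarith only [hl2, hl2'])
    (show Real.log 2 / 4 ≤ 0.1732868 by linarith only [hl2, hl2']) (show (0.07580375 : ℝ) ≤ 1 - 4 * Real.log 2 / (2 * (3 / 2)) by linarith only [hl2, hl2'])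
    (show 1 - 4 * Real.log 2 / (2 * (3 / 2)) ≤ 0.07580377 by linarith only [hl2, hl2']) (by norm_num) (by norm_num)
  obtain ⟨hc3l, hc3h⟩ := mul_mem_bounds hX3.1 hX3.2 (show (0.63379589 : ℝ) ≤ 1 - Real.log 3 / (2 * (3 / 2)) by linarith only [hl3, hl3'])
    (show 1 - Real.log 3 / (2 * (3 / 2)) ≤ 0.63379591 by linarith only [hl3, hl3']) (by norm_num) (by norm_num)
  obtain ⟨hc9l, hc9h⟩ := mul_mem_bounds (show (0.36620409 : ℝ) ≤ Real.log 3 / 3 by linarith only [hl3, hl3'])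
    (show Real.log 3 / 3 ≤ 0.3662041 by linarith only [hl3, hl3']) (show (0.2675918 : ℝ) ≤ 1 - 2 * Real.log 3 / (2 * (3 / 2)) by linarith only [hl3, hl3'])
    (show 1 - 2 * Real.log 3 / (2 * (3 / 2)) ≤ 0.26759182 by linarith only [hl3, hl3']) (by norm_num) (by norm_num)
  -- the free coefficients (upper bounds; all factors non-negative)
  have hc5 := mul_le_mul hX5 (show 1 - Real.log 5 / (2 * (3 / 2)) ≤ (0.463520703 : ℝ) by linarith only [hl5, hl5'])
    (show (0 : ℝ) ≤ 1 - Real.log 5 / (2 * (3 / 2)) by linarith only [hl5, hl5']) (by norm_num)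
  have hc7 := mul_le_mul hX7 (show 1 - Real.log 7 / (2 * (3 / 2)) ≤ (0.351363284 : ℝ) by linarith only [hl7, hl7'])
    (show (0 : ℝ) ≤ 1 - Real.log 7 / (2 * (3 / 2)) by linarith only [hl7, hl7']) (by norm_num)
  have hc11 := mul_le_mul hX11 (show 1 - Real.log 11 / (2 * (3 / 2)) ≤ (0.20070158 : ℝ) by linarith only [hl11, hl11'])
    (show (0 : ℝ) ≤ 1 - Real.log 11 / (2 * (3 / 2)) by linarith only [hl11, hl11']) (by norm_num)
  have hc13 := mul_le_mul hX13 (show 1 - Real.log 13 / (2 * (3 / 2)) ≤ (0.1450169 : ℝ) by linarith only [hl13, hl13'])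
    (show (0 : ℝ) ≤ 1 - Real.log 13 / (2 * (3 / 2)) by linarith only [hl13, hl13']) (by norm_num)
  have hc17 := mul_le_mul hX17 (show 1 - Real.log 17 / (2 * (3 / 2)) ≤ (0.05559556 : ℝ) by linarith only [hl17, hl17'])
    (show (0 : ℝ) ≤ 1 - Real.log 17 / (2 * (3 / 2)) by linarith only [hl17, hl17']) (by norm_num)
  have hc19 := mul_le_mul hX19 (show 1 - Real.log 19 / (2 * (3 / 2)) ≤ (0.018984 : ℝ) by linarith only [hl19, hl19'])
    (show (0 : ℝ) ≤ 1 - Real.log 19 / (2 * (3 / 2)) by linarith only [hl19, hl19']) (by norm_num)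
  -- abbreviate the coefficients (first re-associate `X * (Y * cos) = (X * Y) * cos`)
  simp only [← mul_assoc]
  set c2 := Real.log 2 / Real.sqrt 2 * (1 - Real.log 2 / (2 * (3 / 2))) with hc2
  set c4 := Real.log 2 / 2 * (1 - 2 * Real.log 2 / (2 * (3 / 2))) with hc4
  set c8 := Real.log 2 / (2 * Real.sqrt 2) * (1 - 3 * Real.log 2 / (2 * (3 / 2))) with hc8
  set c16 := Real.log 2 / 4 * (1 - 4 * Real.log 2 / (2 * (3 / 2))) with hc16
  set c3 := Real.log 3 / Real.sqrt 3 * (1 - Real.log 3 / (2 * (3 / 2))) with hc3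
  set c9 := Real.log 3 / 3 * (1 - 2 * Real.log 3 / (2 * (3 / 2))) with hc9
  set c5 := Real.log 5 / Real.sqrt 5 * (1 - Real.log 5 / (2 * (3 / 2))) with hc5d
  set c7 := Real.log 7 / Real.sqrt 7 * (1 - Real.log 7 / (2 * (3 / 2))) with hc7d
  set c11 := Real.log 11 / Real.sqrt 11 * (1 - Real.log 11 / (2 * (3 / 2))) with hc11d
  set c13 := Real.log 13 / Real.sqrt 13 * (1 - Real.log 13 / (2 * (3 / 2))) with hc13d
  set c17 := Real.log 17 / Real.sqrt 17 * (1 - Real.log 17 / (2 * (3 / 2))) with hc17d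
  set c19 := Real.log 19 / Real.sqrt 19 * (1 - Real.log 19 / (2 * (3 / 2))) with hc19d
  have hx0 : 0 ≤ 1 + x := by linarith
  have hy0 : 0 ≤ 1 + y := by linarith
  -- powers of 2, locked: `h(x) − h(−1) = (1+x)(A + Bx + x²(C + Dx)) ≥ 0`
  have h2pow : -(c2 * x + c4 * (2 * x ^ 2 - 1) + c8 * (4 * x ^ 3 - 3 * x) + c16 * (8 * x ^ 4 - 8 * x ^ 2 + 1)) ≤
      c2 - c4 + c8 - c16 := by
    have hB0 : 0 ≤ 2 * c4 - 4 * c8 := by linarith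
    have hD0 : 0 ≤ 8 * c16 := by linarith
    have hA : 0 ≤ (c2 - 2 * c4 + c8) + (2 * c4 - 4 * c8) * x := by
      have hP := mul_nonneg hB0 hx0
      linarith only [hP, hc2l, hc4h, hc4l, hc8l, hc8h]
    have hC : 0 ≤ (4 * c8 - 8 * c16) + 8 * c16 * x := by
      have hP := mul_nonneg hD0 hx0
      linarith only [hP, hc8l, hc16h, hc16l]
    have key : c2 * x + c4 * (2 * x ^ 2 - 1) + c8 * (4 * x ^ 3 - 3 * x) + c16 * (8 * x ^ 4 - 8 * x ^ 2 + 1) -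
        (-c2 + c4 - c8 + c16) =
        (1 + x) * (((c2 - 2 * c4 + c8) + (2 * c4 - 4 * c8) * x) + x ^ 2 * ((4 * c8 - 8 * c16) + 8 * c16 * x)) := by
      ring
    have hprod := mul_nonneg hx0 (add_nonneg hA (mul_nonneg (sq_nonneg x) hC))
    linarith only [key, hprod]
  -- powers of 3, locked: `c3(1+y) + 2c9(y² − 1) = (1+y)(c3 + 2c9(y−1)) ≥ 0` since `c3 ≥ 4c9`
  have h3pow : -(c3 * y + c9 * (2 * y ^ 2 - 1)) ≤ c3 - c9 := by
    have hc90 : 0 ≤ c9 := by linarith only [hc9l]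
    have hin : 0 ≤ c3 + 2 * c9 * (y - 1) := by
      have hQ := mul_nonneg hc90 hy0
      linarith only [hQ, hc3l, hc9h]
    have key : c3 * y + c9 * (2 * y ^ 2 - 1) + (c3 - c9) = (1 + y) * (c3 + 2 * c9 * (y - 1)) := by ring
    have hprod := mul_nonneg hy0 hin
    linarith only [key, hprod]
  -- the free primes: `−c·cos ≤ c` for `c ≥ 0`
  have hfree : ∀ (c u : ℝ), 0 ≤ c → -(c * Real.cos u) ≤ c := fun c u hc ↦ by
    have h := mul_nonneg hc (show 0 ≤ 1 + Real.cos u by linarith only [Real.neg_one_le_cos u])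
    linarith only [h]
  have h5 := hfree c5 (τ * Real.log 5) (mul_nonneg hX5' (by linarith only [hl5']))
  have h7 := hfree c7 (τ * Real.log 7) (mul_nonneg hX7' (by linarith only [hl7']))
  have h11 := hfree c11 (τ * Real.log 11) (mul_nonneg hX11' (by linarith only [hl11']))
  have h13 := hfree c13 (τ * Real.log 13) (mul_nonneg hX13' (by linarith only [hl13']))
  have h17 := hfree c17 (τ * Real.log 17) (mul_nonneg hX17' (by linarith only [hl17']))
  have h19 := hfree c19 (τ * Real.log 19) (mul_nonneg hX19' (by linarith only [hl19']))
  linarith only [h2pow, h3pow, h5, h7, h11, h13, h17, h19, hc2h, hc4l, hc8h, hc16l, hc3h, hc9l, hc5, hc7, hc11,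
    hc13, hc17, hc19]

end Summit.Ventures.WeilGRH

end
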